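import Summits.ValiantsHypothesis.ValiantsHypothesis.Theorems.KPlusLogSqLawTropicalBMarkedEdgeCoreSixBase

/-!
# Route «KPlusLogSqLaw», crux `TropicalB` (stmt-ValiantsHypothesis-19771) — MARKED-EDGE sector, NESTED-TRIANGLE CORE, ALL sizes, part 1:
# the PAIR STRUCTURE of any realisation (every finite node set)

HONEST FRAMING.  Helper file (cell `pub-symmetroid`, seat val-sym-trop-p4 (g18), 2026-08-28; `--supports stmt-ValiantsHypothesis-19771 --as
helper`).  The lineage's «nested-triangle core» {1,2},{1,3},{2,3},{0,4} (trop-p5 g18 / trop-p4 g17 LAYER2-CORE-g17.md) is KERNEL-impossible on six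
nodes (`CoreSix.nestedTriangle_not_realisable_six`, p664896) and located-exact impossible on m ≤ 8; for m ≥ 9 it is OPEN.  This file proves, for
EVERY finite node set `V`, the structure that the six RELATIVE PERMUTATIONS of a would-be realisation must have (the all-`m` content of the
pairwise exchange, `FourBit.abel_two`): it does NOT prove the law.  Nothing here concerns `TropicalB` in its window, `WeakLifting`, the doors,
`MatrixDescartes` (stmt-ValiantsHypothesis-18050) or VP ≠ VNP.

SETTING (inline, as in the four-bit chain `…MarkedEdgeExchange`).  `V` finite; five MARKED nodes `b : Fin 5 → V` (injective); arc slopes `g`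
live on the marked loops only: `g i j = 0` for `j ≠ i`, `g (b l) (b l) = 2^l`, `g i i = 0` off the marked nodes (no context nodes); covers
`σ : Equiv.Perm V`, presence `ok`, weights `w`, «unique maximiser at `θ`» verbatim as in part 3 of the four-bit chain.  The CORE asks for four
unique maximisers `σB, σC, σE, σZ` whose marked fixed points are exactly `{b1,b2}`, `{b1,b3}`, `{b2,b3}`, `{b0,b4}` (slopes 6, 10, 12, 17).

CONTENTS.
* `slope_eq_sum_marked` — the slope of a cover is `∑ l, [σ (b l) = b l]·2^l`; `slope_B/C/E/Z` = 6/10/12/17; `theta_order` (θB < θC < θE < θZ).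
* `pair_dichotomy` — the pair exchange WITHOUT a slope-gap hypothesis: for unique maximisers `σ₁` (at `θ₁`) and `σ₂` (at `θ₂ > θ₁`) and a
  point `a` moved by `π = σ₁⁻¹σ₂`, either the cycle of `a` is all of `π`, or the mixed cover «`σ₂` on the cycle of `a`, `σ₁` elsewhere» has slope
  STRICTLY between the two slopes (refines `FourBit.isCycle_of_pair`).
* `core_BC_isCycle`, `core_BE_isCycle`, `core_CE_isCycle` — the three TRIANGLE pairs differ by ONE cycle.
* `core_BZ_structure`, `core_CZ_structure`, `core_EZ_structure` — for `X ∈ {B,C,E}`, every point moved by `σX⁻¹σZ` lies either on the cycle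
  through `b4` (which also passes through the two marked fixed points of `X`) or on the cycle through `b0`, and the latter avoids `b4` and the
  fixed points of `X` unless it IS the former: `σX⁻¹σZ` has one cycle, or exactly two with `b0` split off.
-/

set_option linter.dupNamespace false
set_option autoImplicit false

namespace Summit.ValiantsHypothesis.ValiantsHypothesis.Theorems.KPlusLogSqLaw
namespace MarkedEdge
namespace Core

open Finset

variable {V : Type*} [Fintype V] [DecidableEq V]

/-! ### Slopes in the marked-edge setting with five marked nodes -/

/-- **Slope = marked fixed points.**  With slopes on the five marked loops only, the slope of a cover `σ` is
`∑ l, (if σ (b l) = b l then 2^l else 0)`. [folklore] -/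
theorem slope_eq_sum_marked (g : V → V → ℤ) (b : Fin 5 → V) (hb : Function.Injective b)
    (hoff : ∀ i j, j ≠ i → g i j = 0) (hmark : ∀ l, g (b l) (b l) = (2 : ℤ) ^ (l : ℕ))
    (haux : ∀ i, (∀ l, b l ≠ i) → g i i = 0) (σ : Equiv.Perm V) :
    (∑ i, g i (σ i)) = ∑ l : Fin 5, (if σ (b l) = b l then (2 : ℤ) ^ (l : ℕ) else 0) := by
  classical
  have h1 : (∑ i, g i (σ i)) = ∑ i, (if σ i = i then g i i else 0) := by
    refine Finset.sum_congr rfl fun i _ => ?_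
    split_ifs with h
    · rw [h]
    · exact hoff i (σ i) h
  rw [h1, ← Finset.sum_subset (Finset.subset_univ (Finset.univ.image b))]
  · rw [Finset.sum_image (fun x _ y _ h => hb h)]
    refine Finset.sum_congr rfl fun l _ => ?_
    split_ifs <;> simp [hmark]
  · intro i _ hi
    have hne : ∀ l, b l ≠ i := fun l h => hi (Finset.mem_image.mpr ⟨l, Finset.mem_univ _, h⟩)
    split_ifs
    · exact haux i hne
    · rfl

/-- slope 6 of a cover with marked fixed points exactly `{b1, b2}`. [folklore] -/
theorem slope_B (g : V → V → ℤ) (b : Fin 5 → V) (hb : Function.Injective b)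
    (hoff : ∀ i j, j ≠ i → g i j = 0) (hmark : ∀ l, g (b l) (b l) = (2 : ℤ) ^ (l : ℕ))
    (haux : ∀ i, (∀ l, b l ≠ i) → g i i = 0) (σ : Equiv.Perm V)
    (h0 : σ (b 0) ≠ b 0) (h1 : σ (b 1) = b 1) (h2 : σ (b 2) = b 2) (h3 : σ (b 3) ≠ b 3) (h4 : σ (b 4) ≠ b 4) :
    (∑ i, g i (σ i)) = 6 := by
  rw [slope_eq_sum_marked g b hb hoff hmark haux, Fin.sum_univ_five]
  simp [h0, h1, h2, h3, h4]

/-- slope 10 of a cover with marked fixed points exactly `{b1, b3}`. [folklore] -/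
theorem slope_C (g : V → V → ℤ) (b : Fin 5 → V) (hb : Function.Injective b)
    (hoff : ∀ i j, j ≠ i → g i j = 0) (hmark : ∀ l, g (b l) (b l) = (2 : ℤ) ^ (l : ℕ))
    (haux : ∀ i, (∀ l, b l ≠ i) → g i i = 0) (σ : Equiv.Perm V)
    (h0 : σ (b 0) ≠ b 0) (h1 : σ (b 1) = b 1) (h2 : σ (b 2) ≠ b 2) (h3 : σ (b 3) = b 3) (h4 : σ (b 4) ≠ b 4) :
    (∑ i, g i (σ i)) = 10 := by
  rw [slope_eq_sum_marked g b hb hoff hmark haux, Fin.sum_univ_five]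
  simp [h0, h1, h2, h3, h4]

/-- slope 12 of a cover with marked fixed points exactly `{b2, b3}`. [folklore] -/
theorem slope_E (g : V → V → ℤ) (b : Fin 5 → V) (hb : Function.Injective b)
    (hoff : ∀ i j, j ≠ i → g i j = 0) (hmark : ∀ l, g (b l) (b l) = (2 : ℤ) ^ (l : ℕ))
    (haux : ∀ i, (∀ l, b l ≠ i) → g i i = 0) (σ : Equiv.Perm V)
    (h0 : σ (b 0) ≠ b 0) (h1 : σ (b 1) ≠ b 1) (h2 : σ (b 2) = b 2) (h3 : σ (b 3) = b 3) (h4 : σ (b 4) ≠ b 4) :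
    (∑ i, g i (σ i)) = 12 := by
  rw [slope_eq_sum_marked g b hb hoff hmark haux, Fin.sum_univ_five]
  simp [h0, h1, h2, h3, h4]

/-- slope 17 of a cover with marked fixed points exactly `{b0, b4}`. [folklore] -/
theorem slope_Z (g : V → V → ℤ) (b : Fin 5 → V) (hb : Function.Injective b)
    (hoff : ∀ i j, j ≠ i → g i j = 0) (hmark : ∀ l, g (b l) (b l) = (2 : ℤ) ^ (l : ℕ))
    (haux : ∀ i, (∀ l, b l ≠ i) → g i i = 0) (σ : Equiv.Perm V)
    (h0 : σ (b 0) = b 0) (h1 : σ (b 1) ≠ b 1) (h2 : σ (b 2) ≠ b 2) (h3 : σ (b 3) ≠ b 3) (h4 : σ (b 4) = b 4) :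
    (∑ i, g i (σ i)) = 17 := by
  rw [slope_eq_sum_marked g b hb hoff hmark haux, Fin.sum_univ_five]
  simp [h0, h1, h2, h3, h4]

/-! ### The pair exchange without a slope gap -/

omit [DecidableEq V] in
/-- pointwise description of the mixed cover «`σ₂` on the cycle of `a`, `σ₁` elsewhere». [folklore] -/
theorem mixed_apply [DecidableEq V] (σ₁ σ₂ : Equiv.Perm V) (a i : V) :
    (σ₁ * (σ₁⁻¹ * σ₂).cycleOf a) i = if (σ₁⁻¹ * σ₂).SameCycle a i then σ₂ i else σ₁ i := by
  split_ifs with h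
  · rw [Equiv.Perm.mul_apply, h.cycleOf_apply]; simp
  · rw [Equiv.Perm.mul_apply, Equiv.Perm.cycleOf_apply_of_not_sameCycle h]

/-- **PAIR DICHOTOMY.**  `σ₁` the unique maximiser at `θ₁`, `σ₂` at `θ₂ > θ₁`, `a` moved by `π = σ₁⁻¹σ₂`.  Then EITHER the cycle of `π`
through `a` is all of `π`, OR the mixed cover `F = σ₁ · π.cycleOf a` (= `σ₂` on that cycle, `σ₁` elsewhere) has slope strictly between the
slopes of `σ₁` and `σ₂`.  (Abel summation on the two factorisations `F ⊎ F'` of `σ₁ ⊎ σ₂`; `FourBit.isCycle_of_pair` is the case in which the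
second alternative is excluded by a slope gap.) [this seat's lemma] -/
theorem pair_dichotomy (ok : V → V → Prop) (w g : V → V → ℤ) {θ₁ θ₂ : ℤ} (hθ : θ₁ < θ₂)
    {σ₁ σ₂ : Equiv.Perm V}
    (h₁ : (∀ i, ok i (σ₁ i)) ∧ ∀ τ : Equiv.Perm V, τ ≠ σ₁ → (∀ i, ok i (τ i)) →
      ∑ i, (w i (τ i) + θ₁ * g i (τ i)) < ∑ i, (w i (σ₁ i) + θ₁ * g i (σ₁ i)))
    (h₂ : (∀ i, ok i (σ₂ i)) ∧ ∀ τ : Equiv.Perm V, τ ≠ σ₂ → (∀ i, ok i (τ i)) →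
      ∑ i, (w i (τ i) + θ₂ * g i (τ i)) < ∑ i, (w i (σ₂ i) + θ₂ * g i (σ₂ i)))
    {a : V} (ha : (σ₁⁻¹ * σ₂) a ≠ a) :
    (σ₁⁻¹ * σ₂).cycleOf a = σ₁⁻¹ * σ₂ ∨
      ((∑ i, g i (σ₁ i)) < ∑ i, g i ((σ₁ * (σ₁⁻¹ * σ₂).cycleOf a) i) ∧
        (∑ i, g i ((σ₁ * (σ₁⁻¹ * σ₂).cycleOf a) i)) < ∑ i, g i (σ₂ i)) := by
  set π : Equiv.Perm V := σ₁⁻¹ * σ₂ with hπ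
  set ρ : Equiv.Perm V := π.cycleOf a with hρ
  have hρs : ∀ i, π.SameCycle a i → ρ i = π i := fun i h => h.cycleOf_apply
  have hρn : ∀ i, ¬ π.SameCycle a i → ρ i = i := fun i h => Equiv.Perm.cycleOf_apply_of_not_sameCycle h
  have hρs' : ∀ i, π.SameCycle a i → ρ⁻¹ i = π⁻¹ i := fun i h => by
    rw [hρ, Equiv.Perm.cycleOf_inv]; exact (Equiv.Perm.sameCycle_inv.mpr h).cycleOf_apply
  have hρn' : ∀ i, ¬ π.SameCycle a i → ρ⁻¹ i = i := fun i h => by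
    rw [hρ, Equiv.Perm.cycleOf_inv]; exact Equiv.Perm.cycleOf_apply_of_not_sameCycle (by rwa [Equiv.Perm.sameCycle_inv])
  have hπi : ∀ i, σ₁ (π i) = σ₂ i := fun i => by simp [hπ]
  have hπi' : ∀ i, σ₂ (π⁻¹ i) = σ₁ i := fun i => by simp [hπ]
  set F₁ : Equiv.Perm V := σ₁ * ρ with hF₁
  set F₂ : Equiv.Perm V := σ₂ * ρ⁻¹ with hF₂
  have hdec : ∀ i, (F₁ i = σ₁ i ∧ F₂ i = σ₂ i) ∨ (F₁ i = σ₂ i ∧ F₂ i = σ₁ i) := by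
    intro i
    by_cases h : π.SameCycle a i
    · right
      exact ⟨by rw [hF₁, Equiv.Perm.mul_apply, hρs i h, hπi], by rw [hF₂, Equiv.Perm.mul_apply, hρs' i h, hπi']⟩
    · left
      exact ⟨by rw [hF₁, Equiv.Perm.mul_apply, hρn i h], by rw [hF₂, Equiv.Perm.mul_apply, hρn' i h]⟩
  have hok₁ : ∀ i, ok i (F₁ i) := fun i => by
    rcases hdec i with ⟨h, -⟩ | ⟨h, -⟩ <;> rw [h]
    exacts [h₁.1 i, h₂.1 i]
  have hok₂ : ∀ i, ok i (F₂ i) := fun i => by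
    rcases hdec i with ⟨-, h⟩ | ⟨-, h⟩ <;> rw [h]
    exacts [h₂.1 i, h₁.1 i]
  have hW : (∑ i, w i (F₁ i)) + ∑ i, w i (F₂ i) = (∑ i, w i (σ₁ i)) + ∑ i, w i (σ₂ i) := by
    rw [← Finset.sum_add_distrib, ← Finset.sum_add_distrib]
    exact Finset.sum_congr rfl fun i _ => by
      rcases hdec i with ⟨hx, hy⟩ | ⟨hx, hy⟩ <;> rw [hx, hy]; ring
  have hG : (∑ i, g i (F₁ i)) + ∑ i, g i (F₂ i) = (∑ i, g i (σ₁ i)) + ∑ i, g i (σ₂ i) := by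
    rw [← Finset.sum_add_distrib, ← Finset.sum_add_distrib]
    exact Finset.sum_congr rfl fun i _ => by
      rcases hdec i with ⟨hx, hy⟩ | ⟨hx, hy⟩ <;> rw [hx, hy]; ring
  have hρa : ρ a = π a := hρs a (Equiv.Perm.SameCycle.refl π a)
  by_cases hlo : (∑ i, g i (F₁ i)) ≤ ∑ i, g i (σ₁ i)
  · -- `F₁` low: Abel forces `F₁ = σ₁`, i.e. `ρ = 1` — impossible since `ρ a = π a ≠ a`
    exfalso
    have hs : (∑ i, g i (σ₂ i)) ≤ ∑ i, g i (F₂ i) := by linarith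
    obtain ⟨e₁, -⟩ := FourBit.abel_two hθ hW hG hs (FourBit.score_le_of_isMax ok w g h₁ hok₁)
      (FourBit.score_le_of_isMax ok w g h₂ hok₂)
    have hF : F₁ = σ₁ := by
      by_contra hne₁
      exact absurd e₁ (ne_of_lt (FourBit.score_lt_of_isMax ok w g h₁ hok₁ hne₁))
    have hρ1 : ρ = 1 := by
      have := congrArg (fun τ => σ₁⁻¹ * τ) hF
      simpa [hF₁] using this
    apply ha
    have : ρ a = a := by rw [hρ1, Equiv.Perm.one_apply]
    rw [← hρa, this]
  · by_cases hhi : (∑ i, g i (σ₂ i)) ≤ ∑ i, g i (F₁ i)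
    · -- `F₁` high: Abel with the factors swapped forces `F₁ = σ₂`, i.e. `ρ = π`
      left
      have hW' : (∑ i, w i (F₂ i)) + ∑ i, w i (F₁ i) = (∑ i, w i (σ₁ i)) + ∑ i, w i (σ₂ i) := by linarith
      have hG' : (∑ i, g i (F₂ i)) + ∑ i, g i (F₁ i) = (∑ i, g i (σ₁ i)) + ∑ i, g i (σ₂ i) := by linarith
      obtain ⟨-, e₂⟩ := FourBit.abel_two hθ hW' hG' hhi (FourBit.score_le_of_isMax ok w g h₁ hok₂)
        (FourBit.score_le_of_isMax ok w g h₂ hok₁)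
      have hF : F₁ = σ₂ := by
        by_contra hne₂
        exact absurd e₂ (ne_of_lt (FourBit.score_lt_of_isMax ok w g h₂ hok₁ hne₂))
      have hρπ : ρ = π := by
        have := congrArg (fun τ => σ₁⁻¹ * τ) hF
        simpa [hF₁, hπ] using this
      exact hρπ
    · right
      push Not at hlo hhi
      exact ⟨hlo, hhi⟩

/-- If the cycle of `a` is all of `π`, every point moved by `π` lies on it. [folklore] -/
theorem sameCycle_of_cycleOf_eq {π : Equiv.Perm V} {a x : V} (h : π.cycleOf a = π) (hx : π x ≠ x) : π.SameCycle a x := by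
  by_contra hn
  apply hx
  have := Equiv.Perm.cycleOf_apply_of_not_sameCycle hn
  rwa [h] at this

omit [Fintype V] [DecidableEq V] in
/-- `σ₁⁻¹σ₂` moves `x` iff `σ₁ x ≠ σ₂ x`. [folklore] -/
theorem rel_apply_ne_iff (σ₁ σ₂ : Equiv.Perm V) (x : V) : (σ₁⁻¹ * σ₂) x ≠ x ↔ σ₁ x ≠ σ₂ x := by
  rw [Equiv.Perm.mul_apply, ne_eq, ne_eq, Equiv.Perm.inv_eq_iff_eq]
  exact ⟨fun h h' => h h'.symm, fun h h' => h h'.symm⟩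

/-! ### The nested-triangle core: slopes and parameter order -/

section Core

variable (ok : V → V → Prop) (w g : V → V → ℤ) (b : Fin 5 → V)

/-- **Parameter order.**  In any realisation of the core, `θB < θC < θE < θZ` (slopes 6 < 10 < 12 < 17). [folklore] -/
theorem theta_order (hb : Function.Injective b)
    (hoff : ∀ i j, j ≠ i → g i j = 0) (hmark : ∀ l, g (b l) (b l) = (2 : ℤ) ^ (l : ℕ)) (haux : ∀ i, (∀ l, b l ≠ i) → g i i = 0)
    {θB θC θE θZ : ℤ} {σB σC σE σZ : Equiv.Perm V}
    (hB : (∀ i, ok i (σB i)) ∧ ∀ τ : Equiv.Perm V, τ ≠ σB → (∀ i, ok i (τ i)) →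
      ∑ i, (w i (τ i) + θB * g i (τ i)) < ∑ i, (w i (σB i) + θB * g i (σB i)))
    (hC : (∀ i, ok i (σC i)) ∧ ∀ τ : Equiv.Perm V, τ ≠ σC → (∀ i, ok i (τ i)) →
      ∑ i, (w i (τ i) + θC * g i (τ i)) < ∑ i, (w i (σC i) + θC * g i (σC i)))
    (hE : (∀ i, ok i (σE i)) ∧ ∀ τ : Equiv.Perm V, τ ≠ σE → (∀ i, ok i (τ i)) →
      ∑ i, (w i (τ i) + θE * g i (τ i)) < ∑ i, (w i (σE i) + θE * g i (σE i)))
    (hZ : (∀ i, ok i (σZ i)) ∧ ∀ τ : Equiv.Perm V, τ ≠ σZ → (∀ i, ok i (τ i)) →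
      ∑ i, (w i (τ i) + θZ * g i (τ i)) < ∑ i, (w i (σZ i) + θZ * g i (σZ i)))
    (hB0 : σB (b 0) ≠ b 0) (hB1 : σB (b 1) = b 1) (hB2 : σB (b 2) = b 2) (hB3 : σB (b 3) ≠ b 3) (hB4 : σB (b 4) ≠ b 4)
    (hC0 : σC (b 0) ≠ b 0) (hC1 : σC (b 1) = b 1) (hC2 : σC (b 2) ≠ b 2) (hC3 : σC (b 3) = b 3) (hC4 : σC (b 4) ≠ b 4)
    (hE0 : σE (b 0) ≠ b 0) (hE1 : σE (b 1) ≠ b 1) (hE2 : σE (b 2) = b 2) (hE3 : σE (b 3) = b 3) (hE4 : σE (b 4) ≠ b 4)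
    (hZ0 : σZ (b 0) = b 0) (hZ1 : σZ (b 1) ≠ b 1) (hZ2 : σZ (b 2) ≠ b 2) (hZ3 : σZ (b 3) ≠ b 3) (hZ4 : σZ (b 4) = b 4) :
    θB < θC ∧ θC < θE ∧ θE < θZ := by
  have sB := slope_B g b hb hoff hmark haux σB hB0 hB1 hB2 hB3 hB4
  have sC := slope_C g b hb hoff hmark haux σC hC0 hC1 hC2 hC3 hC4
  have sE := slope_E g b hb hoff hmark haux σE hE0 hE1 hE2 hE3 hE4
  have sZ := slope_Z g b hb hoff hmark haux σZ hZ0 hZ1 hZ2 hZ3 hZ4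
  exact ⟨CoreSix.theta_lt_of_isMax ok w g hB hC (by rw [sB, sC]; norm_num),
    CoreSix.theta_lt_of_isMax ok w g hC hE (by rw [sC, sE]; norm_num),
    CoreSix.theta_lt_of_isMax ok w g hE hZ (by rw [sE, sZ]; norm_num)⟩

/-! ### The three triangle pairs differ by one cycle -/

/-- **(B,C): one cycle.**  In any realisation of the core, `σB⁻¹σC` is a cycle (the covers with patterns {b1,b2} and {b1,b3} differ along ONE
alternating cycle, through `b2` and `b3`).  Slope gap: a cover mixing their arcs has slope in {2, 6, 10, 14}. [this seat's lemma] -/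
theorem core_BC_isCycle (hb : Function.Injective b)
    (hoff : ∀ i j, j ≠ i → g i j = 0) (hmark : ∀ l, g (b l) (b l) = (2 : ℤ) ^ (l : ℕ)) (haux : ∀ i, (∀ l, b l ≠ i) → g i i = 0)
    {θB θC : ℤ} {σB σC : Equiv.Perm V} (hθ : θB < θC)
    (hB : (∀ i, ok i (σB i)) ∧ ∀ τ : Equiv.Perm V, τ ≠ σB → (∀ i, ok i (τ i)) →
      ∑ i, (w i (τ i) + θB * g i (τ i)) < ∑ i, (w i (σB i) + θB * g i (σB i)))
    (hC : (∀ i, ok i (σC i)) ∧ ∀ τ : Equiv.Perm V, τ ≠ σC → (∀ i, ok i (τ i)) →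
      ∑ i, (w i (τ i) + θC * g i (τ i)) < ∑ i, (w i (σC i) + θC * g i (σC i)))
    (hB0 : σB (b 0) ≠ b 0) (hB1 : σB (b 1) = b 1) (hB2 : σB (b 2) = b 2) (hB3 : σB (b 3) ≠ b 3) (hB4 : σB (b 4) ≠ b 4)
    (hC0 : σC (b 0) ≠ b 0) (hC1 : σC (b 1) = b 1) (hC2 : σC (b 2) ≠ b 2) (hC3 : σC (b 3) = b 3) (hC4 : σC (b 4) ≠ b 4) :
    (σB⁻¹ * σC).IsCycle := by
  have sB := slope_B g b hb hoff hmark haux σB hB0 hB1 hB2 hB3 hB4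
  have sC := slope_C g b hb hoff hmark haux σC hC0 hC1 hC2 hC3 hC4
  have hne : σB ≠ σC := fun h => hB3 (by rw [h]; exact hC3)
  refine FourBit.isCycle_of_pair ok w g hθ hne hB hC fun F hF => ?_
  rw [sB, sC, slope_eq_sum_marked g b hb hoff hmark haux F, Fin.sum_univ_five]
  have f0 : F (b 0) ≠ b 0 := by rcases hF (b 0) with h | h <;> rw [h]; exacts [hB0, hC0]
  have f1 : F (b 1) = b 1 := by rcases hF (b 1) with h | h <;> rw [h]; exacts [hB1, hC1]
  have f4 : F (b 4) ≠ b 4 := by rcases hF (b 4) with h | h <;> rw [h]; exacts [hB4, hC4]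
  by_cases f2 : F (b 2) = b 2 <;> by_cases f3 : F (b 3) = b 3 <;> simp [f0, f1, f2, f3, f4]

/-- **(B,E): one cycle** (through `b1` and `b3`; mixed slopes in {4, 6, 12, 14}). [this seat's lemma] -/
theorem core_BE_isCycle (hb : Function.Injective b)
    (hoff : ∀ i j, j ≠ i → g i j = 0) (hmark : ∀ l, g (b l) (b l) = (2 : ℤ) ^ (l : ℕ)) (haux : ∀ i, (∀ l, b l ≠ i) → g i i = 0)
    {θB θE : ℤ} {σB σE : Equiv.Perm V} (hθ : θB < θE)
    (hB : (∀ i, ok i (σB i)) ∧ ∀ τ : Equiv.Perm V, τ ≠ σB → (∀ i, ok i (τ i)) →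
      ∑ i, (w i (τ i) + θB * g i (τ i)) < ∑ i, (w i (σB i) + θB * g i (σB i)))
    (hE : (∀ i, ok i (σE i)) ∧ ∀ τ : Equiv.Perm V, τ ≠ σE → (∀ i, ok i (τ i)) →
      ∑ i, (w i (τ i) + θE * g i (τ i)) < ∑ i, (w i (σE i) + θE * g i (σE i)))
    (hB0 : σB (b 0) ≠ b 0) (hB1 : σB (b 1) = b 1) (hB2 : σB (b 2) = b 2) (hB3 : σB (b 3) ≠ b 3) (hB4 : σB (b 4) ≠ b 4)
    (hE0 : σE (b 0) ≠ b 0) (hE1 : σE (b 1) ≠ b 1) (hE2 : σE (b 2) = b 2) (hE3 : σE (b 3) = b 3) (hE4 : σE (b 4) ≠ b 4) :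
    (σB⁻¹ * σE).IsCycle := by
  have sB := slope_B g b hb hoff hmark haux σB hB0 hB1 hB2 hB3 hB4
  have sE := slope_E g b hb hoff hmark haux σE hE0 hE1 hE2 hE3 hE4
  have hne : σB ≠ σE := fun h => hB3 (by rw [h]; exact hE3)
  refine FourBit.isCycle_of_pair ok w g hθ hne hB hE fun F hF => ?_
  rw [sB, sE, slope_eq_sum_marked g b hb hoff hmark haux F, Fin.sum_univ_five]
  have f0 : F (b 0) ≠ b 0 := by rcases hF (b 0) with h | h <;> rw [h]; exacts [hB0, hE0]
  have f2 : F (b 2) = b 2 := by rcases hF (b 2) with h | h <;> rw [h]; exacts [hB2, hE2]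
  have f4 : F (b 4) ≠ b 4 := by rcases hF (b 4) with h | h <;> rw [h]; exacts [hB4, hE4]
  by_cases f1 : F (b 1) = b 1 <;> by_cases f3 : F (b 3) = b 3 <;> simp [f0, f1, f2, f3, f4]

/-- **(C,E): one cycle** (through `b1` and `b2`; mixed slopes in {8, 10, 12, 14}). [this seat's lemma] -/
theorem core_CE_isCycle (hb : Function.Injective b)
    (hoff : ∀ i j, j ≠ i → g i j = 0) (hmark : ∀ l, g (b l) (b l) = (2 : ℤ) ^ (l : ℕ)) (haux : ∀ i, (∀ l, b l ≠ i) → g i i = 0)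
    {θC θE : ℤ} {σC σE : Equiv.Perm V} (hθ : θC < θE)
    (hC : (∀ i, ok i (σC i)) ∧ ∀ τ : Equiv.Perm V, τ ≠ σC → (∀ i, ok i (τ i)) →
      ∑ i, (w i (τ i) + θC * g i (τ i)) < ∑ i, (w i (σC i) + θC * g i (σC i)))
    (hE : (∀ i, ok i (σE i)) ∧ ∀ τ : Equiv.Perm V, τ ≠ σE → (∀ i, ok i (τ i)) →
      ∑ i, (w i (τ i) + θE * g i (τ i)) < ∑ i, (w i (σE i) + θE * g i (σE i)))
    (hC0 : σC (b 0) ≠ b 0) (hC1 : σC (b 1) = b 1) (hC2 : σC (b 2) ≠ b 2) (hC3 : σC (b 3) = b 3) (hC4 : σC (b 4) ≠ b 4)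
    (hE0 : σE (b 0) ≠ b 0) (hE1 : σE (b 1) ≠ b 1) (hE2 : σE (b 2) = b 2) (hE3 : σE (b 3) = b 3) (hE4 : σE (b 4) ≠ b 4) :
    (σC⁻¹ * σE).IsCycle := by
  have sC := slope_C g b hb hoff hmark haux σC hC0 hC1 hC2 hC3 hC4
  have sE := slope_E g b hb hoff hmark haux σE hE0 hE1 hE2 hE3 hE4
  have hne : σC ≠ σE := fun h => hC2 (by rw [h]; exact hE2)
  refine FourBit.isCycle_of_pair ok w g hθ hne hC hE fun F hF => ?_
  rw [sC, sE, slope_eq_sum_marked g b hb hoff hmark haux F, Fin.sum_univ_five]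
  have f0 : F (b 0) ≠ b 0 := by rcases hF (b 0) with h | h <;> rw [h]; exacts [hC0, hE0]
  have f3 : F (b 3) = b 3 := by rcases hF (b 3) with h | h <;> rw [h]; exacts [hC3, hE3]
  have f4 : F (b 4) ≠ b 4 := by rcases hF (b 4) with h | h <;> rw [h]; exacts [hC4, hE4]
  by_cases f1 : F (b 1) = b 1 <;> by_cases f2 : F (b 2) = b 2 <;> simp [f0, f1, f2, f3, f4]

end Core

end Core
end MarkedEdge
end Summit.ValiantsHypothesis.ValiantsHypothesis.Theorems.KPlusLogSqLaw
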